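import Literature.Probability.RandomPlanarGeometry.KlebanZagierCrossing
import HarnessLib

/-!
# Kleban–Zagier, Theorem 2: the statement as printed is false (constant conformal block)

Companion to `KlebanZagierCrossing.lean`, which transcribes P. Kleban, D. Zagier, *Crossing
probabilities and modular forms*, J. Stat. Phys. **113** (2003), 431–454 (arXiv:math-ph/0209023),
§5, Theorems 1 and 2, as the named facts `KlebanZagier.theorem1`, `KlebanZagier.theorem2`.

**`KlebanZagier.theorem2` — a faithful transcription of the printed Theorem 2 — is false**, and this
file proves `¬ KlebanZagier.theorem2` (`KlebanZagier.theorem2_false`).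

* The paper's definition (§5, before Theorem 1): "if `Π(r) = ∑_{n=0}^∞ aₙ q̂^{n+α}` with `α ∈ ℝ` and
  `a₀ ≠ 0`, we call `Π(r)` a conformal block of dimension `α`" (`q̂ = e^{-πr}`) admits `α = 0`,
  `a = (a₀, 0, 0, …)`, i.e. any non-zero constant function.
* Theorem 2 (§5): "Let `Π₁(r)` be any function on the positive real axis such that (i′) `Π₁(r)` is
  a conformal block of dimension `α ∈ ℝ` with coefficients `aₙ` of polynomial growth;
  (ii) `Π₁(1/r) = 1 - Π₁(r)`. Then `0 < α ≤ 1/2` and `Π₁(r) = Π_h(r;α)`."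
* Counterexample: `Π₁ ≡ 1/2` is a conformal block of dimension `α = 0` (`a₀ = 1/2`, `aₙ = 0` for
  `n ≥ 1`, trivially of polynomial growth) with `Π₁(1/r) = 1/2 = 1 - Π₁(r)`; the conclusion
  `0 < α` fails (`isConformalBlock_const_half`, `theorem2_false`).
* Where the printed proof uses more than it states: "`ν_∞(f)` equals `α` if `α ≠ 0` and is `≥ 1`
  if `α = 0`. Eq. (nogzs) [the valence formula `ν_∞ + ν_1 + ½ν_i + Σ ν_P = k/4 = 1/2` on `Γ_θ`]
  therefore implies that `0 < α ≤ 1/2`" — reading off `ν_∞(f₁)` and applying the valence formula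
  to `f₁ = P₁′` requires `f₁ ≢ 0`, i.e. that `Π₁` is **not constant**. With that (tacit) hypothesis
  the argument is complete: polynomial growth of `aₙ` makes `f₁` holomorphic at both cusps
  (`ν_∞, ν_1 ≥ 0`), `f₁|₂S = -f₁` plus the growth bound exclude `α < 0`, the valence formula then
  forces `0 < α ≤ 1/2`, `ν_1(f₁) = 1/2 - α` and no zeros in `ℍ`, and comparison with
  `η(τ)^{20-48α}/(η(τ/2)η(2τ))^{8-24α} = 2^{-4α} ϑ₃(τ)⁴ (λ(1-λ))^α` (same weight, multiplier and
  divisor; eq. (pihpr): `(d/dτ) F(λ(τ);κ) = πi Γ(2α)/Γ(α)² ϑ₃⁴ (λ(1-λ))^α`, `α = 1 - 4/κ`) gives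
  `Π₁ = Π_h(·;α)` after fixing the constant by (ii) at `r = 1`.
* **Corrected statement** (not vendored here as a named fact — D-0026; recorded for the planner):
  `theorem2` with the additional hypothesis `∃ r s, 0 < r ∧ 0 < s ∧ Π₁ r ≠ Π₁ s` ("`Π₁` non-constant
  on the positive real axis"; given (ii), equivalently `Π₁ ≢ 1/2`). Theorem 1 (`theorem1`) is
  unaffected: it assumes `α > 0`, so `P′ = πi ∑ aₙ (n+α) q̂^{n+α}` has leading coefficient
  `πi α a₀ ≠ 0`.

## References

* P. Kleban, D. Zagier, *Crossing probabilities and modular forms*, J. Stat. Phys. 113 (2003),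
  431–454, §5 (definition of conformal block; Theorem 2 and its proof). [KlebanZagier2003]
-/

noncomputable section

namespace Literature.Probability.RandomPlanarGeometry.KlebanZagier

/-- The constant function `1/2` is a conformal block of dimension `0` with coefficients
`(1/2, 0, 0, …)` (immediate from the definition of a conformal block, §5).
[cite: KlebanZagier2003, §5 (definition before Theorem 1)] -/
theorem isConformalBlock_const_half :
    IsConformalBlock (fun _ : ℝ => 1 / 2) 0 (fun n : ℕ => if n = 0 then 1 / 2 else 0) := by
  refine ⟨by simp, fun r _ => ?_⟩
  have h := hasSum_single (f := fun n : ℕ =>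
      (if n = 0 then (1 / 2 : ℝ) else 0) * Real.exp (-(Real.pi * r * ((n : ℝ) + 0)))) 0
    (fun n hn => by simp [hn])
  simpa using h

/-- **Theorem 2 of Kleban–Zagier, as literally stated (= `theorem2`), is false.** Counterexample:
`Π₁ ≡ 1/2`, `α = 0`, `a = (1/2, 0, 0, …)` — a conformal block of dimension `0` with coefficients of
polynomial growth and `Π₁(1/r) = 1 - Π₁(r)`, but `¬ (0 < 0)`. The source's proof needs `P₁′ ≢ 0`
(it reads off `ν_∞(P₁′)` and applies the valence formula on `Γ_θ`), i.e. `Π₁` non-constant; with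
that hypothesis added the statement stands as printed (module docstring).
[cite: KlebanZagier2003, §5 Theorem 2] -/
theorem theorem2_false : ¬ theorem2 := by
  intro h
  have h0 := (h (fun _ => 1 / 2) 0 (fun n => if n = 0 then 1 / 2 else 0)
    isConformalBlock_const_half ⟨1 / 2, 0, fun n => by split_ifs <;> norm_num⟩
    (fun r _ => by norm_num)).1
  exact lt_irrefl 0 h0

end Literature.Probability.RandomPlanarGeometry.KlebanZagier

end
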